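import Summits.QuantumFields.BalabanUV.Beta.GAN24.MixedWordZeroOfWardLetters
import Summits.QuantumFields.BalabanUV.Beta.GAN24.FaceWWordSummable

/-!
# `BalabanUV.Beta.GAN24.FaceWWordVanishingOfWardLetters` — binder row G-an2-4 ∕ (CONV-C), TRANSFER-III («slot the chain», the OWNER gan24-p1's `TRANSFER-III-SIZING.v0_7.md`
# §3(a), second option; R-gan24p1-g46-2): **Part 49's `hW0` — THE LEG-SYMMETRISED `W` FACE WORD VANISHES — FOR ANY PACKED KERNEL CARRYING THE LETTERS (DG)(W-M)(TG)** — MY Part 50b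
# `FaceWWordVanishing.faceWWord_LS_eq_zero` RE-CUT OVER A GENERIC KERNEL `X`, and the instance at the COMB-CHART dressed step `X̃′_j := unitK s_f s_m (GcombSh Lc j)` of row D1's
# literal of record (III′) (G-an2-4 CRUX TEAM (2), leaf prover `b2b-balaban-gan24-formalise-leaf-02`, gen 78)

NOT IN PRINT; OUR BOOKKEEPING ([folklore] BY NAME over `MixedWordZeroOfWardLetters` (this gen: the two mixed face words vanish from the letters), MY Part 48's generic `resp_facePair_swap`
∕ `locStencilFM_mono`, MY Part 50a `FaceWWordSummable` (generic: `summable_pairWord_far`, `biLoc_resp_far(_swap)`, `biLoc_mixOfK_far'(_swap)`, `tsum_facePair_W2SymOfK_zero₂`) and, for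
the instance, an2's (III′) letters `CombChartWardSockets.colM_GcombSh_ward`, `CombChartStepJets.decays_GcombSh ∕ shiftK_GcombSh`; 0 `def`, 0 cited fact, 0 `def … : Prop`, 0 sorry).
HONEST FRAMING (cell contract, verbatim): «discharging `BetaPertH` makes Bałaban's UV stability UNCONDITIONAL — a real constructive-QFT result; it is NOT the continuum limit and NOT
the Clay problem.»  HONEST DEPENDENCY (verbatim): «continuum YM on T⁴ ⇐ BetaPertH ∧ nine spine estimates (0/9 proved); BetaPertH ⇐ (D1) ∧ (D4) ∧ CAP+tail; G-an2-4 gates asym, D1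
and NE2/3/4.»

WHAT (generic `d`, `Lc ≥ 1`; `X : MKer (d+1) (Fib d)` with (DG) `Decays X CK δ`, `δ > 0`, (W-M) `∀ y ρ w, Σ_μ (colM X Lc μ (y − e_μ) ρ w − colM X Lc μ y ρ w) = 0`, (TG) `∀ t, shiftK
(−(Lc•t)) X = X`; first tables `S`, `M` with parity-odd rows, jointly `Lc`-covariant mixed table `M₂` (`LocStencilFM`), coarse bond period `P`, leg modulus `NL ∣ Lc·P`):
* §1 **`faceWWord_LS_eq_zero_of_ward`** — with `W̃ = W2SymOfK X Lc S M 0 M₂` the W face word `Ww(μ,ν;α,β) := Σ_{r′ ∈ box P} Σ'_{u′} [r′_μ ≡ −1][u′_ν ≡ −1]_P · Σ'_{(x,z)} [x_α ≡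
  −1][z_β ≡ −1]_{NL} · W̃ μ r′ ν u′ x z (inl α)(inl β)` satisfies `Ww(κ,κ′;κ₁,κ₂) + Ww(κ′,κ;κ₁,κ₂) + (Ww(κ,κ′;κ₂,κ₁) + Ww(κ′,κ;κ₂,κ₁)) = 0` — MY Part 50b token for token with `X` for `X̃`.
* §2 THE (III′) INSTANCE **`faceWWord_LS_combStep_eq_zero`** at `X̃′_j := unitK s_f s_m (GcombSh Lc j)` (ANY units, every `j`; no in-block-root hypothesis).
(E) (`X̃ = unitK s_f s_m (coDressKBmAt ρ Lc (KInvStep Lc j))`) is MY Part 50b, NOT restated.  Asserts NO value of any table; discharges NOTHING of (C) ∕ (C)sym ∕ `hstep` ∕ `hSrc` ∕ `hSrcX` ∕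
(Q-L) ∕ `(hS, hSall)` ∕ `(hW, hWall)` at (E) or (III′); NEVER «G-an2-4 closed» as (CONV-C); NOT D1, NOT `BetaPertH`, NOT continuum, NOT Clay.  2026-08-25; no existing file touched.
-/

noncomputable section

open Finset
open scoped BigOperators
open Literature.MathematicalPhysics.QuantumFieldTheory
open Literature.MathematicalPhysics.QuantumFieldTheory.Balaban1983to89
open Literature.MathematicalPhysics.QuantumFieldTheory.Balaban1983to89.Beta
open B12Sec2to5 (l1 l1_nonneg)
open B6BondElimination (unitVec)
open ExpKernelCalculus (Site MKer Decays BiLoc VertexFamily shiftK l1_sub_symm Zl Zl_pos Zl_nonneg)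
open OneStepResolventKernel (Fib LocStencil)
open AffineAveraging (box toSite)
open SecondOrderResponse (colM dM K2OfK mixOfK W2SymOfK LocStencilFM)
open BalabanStepJets (locStencil_mono)
open BalabanStepW2 (vertexFamily_mono')
open Summit.QuantumFields.BalabanUV.Beta.TameKernelCalculus (trK)
open Summit.QuantumFields.BalabanUV.Beta.BorderedHessian (sgnK)
open Summit.QuantumFields.BalabanUV.Beta.HessKerDressedUnits (unitK decays_unitK)
open Summit.QuantumFields.BalabanUV.Beta.GAN24.FaceWWordLetters (locStencilFM_mono resp_facePair_swap)
open Summit.QuantumFields.BalabanUV.Beta.GAN24.FaceWWordSummable (biLoc_resp_far biLoc_resp_far_swap biLoc_mixOfK_far' biLoc_mixOfK_far_swap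
  summable_pairWord_far tsum_facePair_W2SymOfK_zero₂)
open Summit.QuantumFields.BalabanUV.Beta.GAN24.ColumnResponseOfWardLetters (colM_ward_unitK shiftK_unitK_of_shiftK)
open Summit.QuantumFields.BalabanUV.Beta.GAN24.MixedWordZeroOfWardLetters (tsum_faceBond_mixWord_eq_zero_of_ward sum_box_tsum_mixWord_swap_eq_zero_of_ward)
open Summit.QuantumFields.BalabanUV.Beta.CombChartStepJets (GcombSh decays_GcombSh shiftK_GcombSh)
open Summit.QuantumFields.BalabanUV.Beta.CombChartWardSockets (colM_GcombSh_ward)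

namespace Summit.QuantumFields.BalabanUV.Beta.GAN24.FaceWWordVanishingOfWardLetters

variable {d : ℕ} {Lc : ℕ} [NeZero Lc]

/-! ## §1 `hW0` from the letters (DG)(W-M)(TG) -/

section Ward

variable {X : MKer (d + 1) (Fib d)} {CK δ : ℝ}

/-- NOT IN PRINT; OUR BOOKKEEPING.  **`hW0` OF PART 49 FOR ANY KERNEL WITH THE LETTERS (DG)(W-M)(TG)** (table scale `Lc`, coarse bond period `P`, any leg modulus dividing `Lc·P`):
with `W̃ = W2SymOfK X Lc S M 0 M₂`, `Ww(κ,κ′;κ₁,κ₂) + Ww(κ′,κ;κ₁,κ₂) + (Ww(κ,κ′;κ₂,κ₁) + Ww(κ′,κ;κ₂,κ₁)) = 0`: the two mixed face words vanish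
(`MixedWordZeroOfWardLetters`) and the response words are odd under the leg exchange (`resp_facePair_swap`, first tables with parity-odd rows) — MY Part 50b's proof token for token. -/
theorem faceWWord_LS_eq_zero_of_ward (hX : Decays X CK δ) (hδ : 0 < δ)
    (hMw : ∀ (y : Site (d + 1)) (ρ : Fin (d + 1)) (w : Site (d + 1)), ∑ μ, (colM X Lc μ (y - unitVec μ) ρ w - colM X Lc μ y ρ w) = 0)
    (hXt : ∀ t : Site (d + 1), shiftK (-((Lc : ℤ) • t)) X = X) {P : ℕ} [NeZero P]
    {S M : Fin (d + 1) → (Fin (d + 1) → ℤ) → MKer (d + 1) (Fib d)} {Cs δs CM δM : ℝ}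
    (hS : LocStencil S Cs δs) (hδs : 0 < δs) (hM : VertexFamily M Lc CM δM) (hδM : 0 < δM)
    (hSrow : ∀ κ u, trK (S κ u) = -sgnK (S κ u)) (hMrow : ∀ ρ w, trK (M ρ w) = -sgnK (M ρ w))
    {M₂ : Fin (d + 1) → Site (d + 1) → Fin (d + 1) → Site (d + 1) → MKer (d + 1) (Fib d)} {C₂ δ₂ : ℝ} (hM₂ : LocStencilFM Lc M₂ C₂ δ₂) (hδ₂ : 0 < δ₂)
    (hM₂t : ∀ (κ : Fin (d + 1)) (u : Site (d + 1)) (ρ : Fin (d + 1)) (w t : Site (d + 1)), M₂ κ (u + (Lc : ℤ) • t) ρ (w + t) = shiftK (-((Lc : ℤ) • t)) (M₂ κ u ρ w))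
    (NL : ℤ) (hNL : NL ∣ (Lc : ℤ) * (P : ℤ)) :
    ∀ κ κ' κ₁ κ₂ : Fin (d + 1),
      (fun μ ν α β : Fin (d + 1) => ∑ r' ∈ box (d + 1) P, ∑' u' : Site (d + 1),
          (if toSite r' μ % (P : ℤ) = (P : ℤ) - 1 then (1 : ℝ) else 0) * (if u' ν % (P : ℤ) = (P : ℤ) - 1 then (1 : ℝ) else 0) *
            ∑' yw : Site (d + 1) × Site (d + 1), (if yw.1 α % NL = NL - 1 then (1 : ℝ) else 0) * (if yw.2 β % NL = NL - 1 then (1 : ℝ) else 0) *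
              W2SymOfK X Lc S M 0 M₂ μ (toSite r') ν u' yw.1 yw.2
                (Sum.inl α) (Sum.inl β)) κ κ' κ₁ κ₂
      + (fun μ ν α β : Fin (d + 1) => ∑ r' ∈ box (d + 1) P, ∑' u' : Site (d + 1),
          (if toSite r' μ % (P : ℤ) = (P : ℤ) - 1 then (1 : ℝ) else 0) * (if u' ν % (P : ℤ) = (P : ℤ) - 1 then (1 : ℝ) else 0) *
            ∑' yw : Site (d + 1) × Site (d + 1), (if yw.1 α % NL = NL - 1 then (1 : ℝ) else 0) * (if yw.2 β % NL = NL - 1 then (1 : ℝ) else 0) *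
              W2SymOfK X Lc S M 0 M₂ μ (toSite r') ν u' yw.1 yw.2
                (Sum.inl α) (Sum.inl β)) κ' κ κ₁ κ₂
      + ((fun μ ν α β : Fin (d + 1) => ∑ r' ∈ box (d + 1) P, ∑' u' : Site (d + 1),
          (if toSite r' μ % (P : ℤ) = (P : ℤ) - 1 then (1 : ℝ) else 0) * (if u' ν % (P : ℤ) = (P : ℤ) - 1 then (1 : ℝ) else 0) *
            ∑' yw : Site (d + 1) × Site (d + 1), (if yw.1 α % NL = NL - 1 then (1 : ℝ) else 0) * (if yw.2 β % NL = NL - 1 then (1 : ℝ) else 0) *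
              W2SymOfK X Lc S M 0 M₂ μ (toSite r') ν u' yw.1 yw.2
                (Sum.inl α) (Sum.inl β)) κ κ' κ₂ κ₁
      + (fun μ ν α β : Fin (d + 1) => ∑ r' ∈ box (d + 1) P, ∑' u' : Site (d + 1),
          (if toSite r' μ % (P : ℤ) = (P : ℤ) - 1 then (1 : ℝ) else 0) * (if u' ν % (P : ℤ) = (P : ℤ) - 1 then (1 : ℝ) else 0) *
            ∑' yw : Site (d + 1) × Site (d + 1), (if yw.1 α % NL = NL - 1 then (1 : ℝ) else 0) * (if yw.2 β % NL = NL - 1 then (1 : ℝ) else 0) *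
              W2SymOfK X Lc S M 0 M₂ μ (toSite r') ν u' yw.1 yw.2
                (Sum.inl α) (Sum.inl β)) κ' κ κ₂ κ₁) = 0 := by
  classical
  -- common rate and the decay of the dressed kernel
  have hLc : 1 ≤ Lc := Nat.one_le_iff_ne_zero.2 (NeZero.ne Lc)
  have hCK0 : 0 ≤ CK := hX.nonneg (Sum.inl 0)
  have hCs : 0 ≤ Cs := (hS 0 0).nonneg (Sum.inl 0)
  have hCM : 0 ≤ CM := (hM 0 0).nonneg (Sum.inl 0)
  have hC₂ : 0 ≤ C₂ := hM₂.nonneg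
  set m₀ : ℝ := min (min (min δ δs) δM) δ₂ with hm₀
  have hm0 : 0 < m₀ := lt_min (lt_min (lt_min hδ hδs) hδM) hδ₂
  have hKm : Decays X CK m₀ :=
    OneStepResolventKernel.decays_mono hX hCK0 le_rfl ((min_le_left _ _).trans ((min_le_left _ _).trans (min_le_left _ _)))
  have hSm : LocStencil S Cs m₀ := locStencil_mono hS hCs ((min_le_left _ _).trans ((min_le_left _ _).trans (min_le_right _ _)))
  have hMm : VertexFamily M Lc CM m₀ := vertexFamily_mono' hM hCM ((min_le_left _ _).trans (min_le_right _ _))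
  have hM₂m : LocStencilFM Lc M₂ C₂ m₀ := locStencilFM_mono hM₂ hC₂ (min_le_right _ _)
  -- the bond masks
  have hχ : ∀ s : ℤ, |(fun s : ℤ => if s % (P : ℤ) = (P : ℤ) - 1 then (1 : ℝ) else 0) s| ≤ 1 := by
    intro s; simp only; split_ifs <;> simp
  have hχP : ∀ (κ : Fin (d + 1)) (u s : Site (d + 1)),
      (fun s : ℤ => if s % (P : ℤ) = (P : ℤ) - 1 then (1 : ℝ) else 0) ((u + (P : ℤ) • s) κ)
        = (fun s : ℤ => if s % (P : ℤ) = (P : ℤ) - 1 then (1 : ℝ) else 0) (u κ) := by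
    intro κ u s
    simp only [Pi.add_apply, Pi.smul_apply, smul_eq_mul, Int.add_mul_emod_self_left]
  -- the leg masks are `Lc·P`-periodic
  have hmN : ∀ (α β : Fin (d + 1)) (y₁ w₀ s : Site (d + 1)),
      (fun yw : Site (d + 1) × Site (d + 1) => (if yw.1 α % NL = NL - 1 then (1 : ℝ) else 0) * (if yw.2 β % NL = NL - 1 then (1 : ℝ) else 0))
          (y₁ + (Lc : ℤ) • ((P : ℤ) • s), w₀ + (Lc : ℤ) • ((P : ℤ) • s))
        = (fun yw : Site (d + 1) × Site (d + 1) => (if yw.1 α % NL = NL - 1 then (1 : ℝ) else 0) * (if yw.2 β % NL = NL - 1 then (1 : ℝ) else 0))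
          (y₁, w₀) := by
    intro α β y₁ w₀ s
    obtain ⟨q, hq⟩ := hNL
    have e : ∀ (v : Site (d + 1)) (γ : Fin (d + 1)), (v + (Lc : ℤ) • ((P : ℤ) • s)) γ % NL = v γ % NL := by
      intro v γ
      have h1 : (v + (Lc : ℤ) • ((P : ℤ) • s)) γ = v γ + NL * (q * s γ) := by
        simp only [Pi.add_apply, Pi.smul_apply, smul_eq_mul]
        rw [← mul_assoc, hq, mul_assoc]
      rw [h1, Int.add_mul_emod_self_left]
    simp only [e]
  have hmb : ∀ (α β : Fin (d + 1)) (yw : Site (d + 1) × Site (d + 1)),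
      |(fun yw : Site (d + 1) × Site (d + 1) => (if yw.1 α % NL = NL - 1 then (1 : ℝ) else 0) * (if yw.2 β % NL = NL - 1 then (1 : ℝ) else 0)) yw| ≤ 1 := by
    intro α β yw; simp only; split_ifs <;> simp
  -- the W face word = response part (the two mixed face words vanish)
  have hWw : ∀ μ ν α β : Fin (d + 1),
      (∑ r' ∈ box (d + 1) P, ∑' u' : Site (d + 1),
          (if toSite r' μ % (P : ℤ) = (P : ℤ) - 1 then (1 : ℝ) else 0) * (if u' ν % (P : ℤ) = (P : ℤ) - 1 then (1 : ℝ) else 0) *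
            ∑' yw : Site (d + 1) × Site (d + 1), (if yw.1 α % NL = NL - 1 then (1 : ℝ) else 0) * (if yw.2 β % NL = NL - 1 then (1 : ℝ) else 0) *
              W2SymOfK X Lc S M 0 M₂ μ (toSite r') ν u' yw.1 yw.2
                (Sum.inl α) (Sum.inl β))
        = (1 / 2 : ℝ) * ∑ r' ∈ box (d + 1) P, ∑' u' : Site (d + 1),
          (if toSite r' μ % (P : ℤ) = (P : ℤ) - 1 then (1 : ℝ) else 0) * (if u' ν % (P : ℤ) = (P : ℤ) - 1 then (1 : ℝ) else 0) *
            ((∑' yw : Site (d + 1) × Site (d + 1), (if yw.1 α % NL = NL - 1 then (1 : ℝ) else 0) * (if yw.2 β % NL = NL - 1 then (1 : ℝ) else 0) *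
                dM (K2OfK X Lc S M ν u') Lc S M μ (toSite r') yw.1 yw.2
                  (Sum.inl α) (Sum.inl β))
             + (∑' yw : Site (d + 1) × Site (d + 1), (if yw.1 α % NL = NL - 1 then (1 : ℝ) else 0) * (if yw.2 β % NL = NL - 1 then (1 : ℝ) else 0) *
                dM (K2OfK X Lc S M μ (toSite r')) Lc S M ν u' yw.1 yw.2
                  (Sum.inl α) (Sum.inl β))) := by
    intro μ ν α β
    -- abbreviations for the four bond-level words
    have hm24 : 0 < m₀ / 2 / 4 := by positivity
    have hm8 : 0 < m₀ / 8 := by positivity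
    have hm82 : 0 < m₀ / 8 / 2 := by positivity
    have s1 : ∀ r' : Fin (d + 1) → ℕ, Summable fun u' : Site (d + 1) => (if u' ν % (P : ℤ) = (P : ℤ) - 1 then (1 : ℝ) else 0) *
        ∑' yw : Site (d + 1) × Site (d + 1), (if yw.1 α % NL = NL - 1 then (1 : ℝ) else 0) * (if yw.2 β % NL = NL - 1 then (1 : ℝ) else 0) *
          mixOfK X Lc M₂ μ (toSite r') ν u' yw.1 yw.2 (Sum.inl α) (Sum.inl β) :=
      fun r' => summable_pairWord_far (N := Lc) hLc hm24 hm24 (toSite r')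
        (fun u' => biLoc_mixOfK_far' (N := Lc) hKm hCK0 hM₂m hm0 μ (toSite r') ν u') (fun u' => if u' ν % (P : ℤ) = (P : ℤ) - 1 then (1 : ℝ) else 0)
        (fun u' => hχ (u' ν)) NL α β (Sum.inl α) (Sum.inl β)
    have s2 : ∀ r' : Fin (d + 1) → ℕ, Summable fun u' : Site (d + 1) => (if u' ν % (P : ℤ) = (P : ℤ) - 1 then (1 : ℝ) else 0) *
        ∑' yw : Site (d + 1) × Site (d + 1), (if yw.1 α % NL = NL - 1 then (1 : ℝ) else 0) * (if yw.2 β % NL = NL - 1 then (1 : ℝ) else 0) *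
          mixOfK X Lc M₂ ν u' μ (toSite r') yw.1 yw.2 (Sum.inl α) (Sum.inl β) :=
      fun r' => summable_pairWord_far (N := Lc) hLc hm24 hm24 (toSite r')
        (fun u' => biLoc_mixOfK_far_swap (N := Lc) hKm hCK0 hM₂m hm0 μ (toSite r') ν u') (fun u' => if u' ν % (P : ℤ) = (P : ℤ) - 1 then (1 : ℝ) else 0)
        (fun u' => hχ (u' ν)) NL α β (Sum.inl α) (Sum.inl β)
    have s3 : ∀ r' : Fin (d + 1) → ℕ, Summable fun u' : Site (d + 1) => (if u' ν % (P : ℤ) = (P : ℤ) - 1 then (1 : ℝ) else 0) *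
        ∑' yw : Site (d + 1) × Site (d + 1), (if yw.1 α % NL = NL - 1 then (1 : ℝ) else 0) * (if yw.2 β % NL = NL - 1 then (1 : ℝ) else 0) *
          dM (K2OfK X Lc S M ν u') Lc S M μ (toSite r') yw.1 yw.2
            (Sum.inl α) (Sum.inl β) :=
      fun r' => summable_pairWord_far (N := Lc) hLc hm82 hm8 (toSite r')
        (fun u' => biLoc_resp_far (N := Lc) hKm hCK0 hm0 hSm hMm μ (toSite r') ν u') (fun u' => if u' ν % (P : ℤ) = (P : ℤ) - 1 then (1 : ℝ) else 0)
        (fun u' => hχ (u' ν)) NL α β (Sum.inl α) (Sum.inl β)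
    have s4 : ∀ r' : Fin (d + 1) → ℕ, Summable fun u' : Site (d + 1) => (if u' ν % (P : ℤ) = (P : ℤ) - 1 then (1 : ℝ) else 0) *
        ∑' yw : Site (d + 1) × Site (d + 1), (if yw.1 α % NL = NL - 1 then (1 : ℝ) else 0) * (if yw.2 β % NL = NL - 1 then (1 : ℝ) else 0) *
          dM (K2OfK X Lc S M μ (toSite r')) Lc S M ν u' yw.1 yw.2
            (Sum.inl α) (Sum.inl β) :=
      fun r' => summable_pairWord_far (N := Lc) hLc hm82 hm8 (toSite r')
        (fun u' => biLoc_resp_far_swap (N := Lc) hKm hCK0 hm0 hSm hMm μ (toSite r') ν u') (fun u' => if u' ν % (P : ℤ) = (P : ℤ) - 1 then (1 : ℝ) else 0)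
        (fun u' => hχ (u' ν)) NL α β (Sum.inl α) (Sum.inl β)
    -- split every bond term into the four pieces
    have hsplit : ∀ r' : Fin (d + 1) → ℕ,
        (∑' u' : Site (d + 1),
          (if toSite r' μ % (P : ℤ) = (P : ℤ) - 1 then (1 : ℝ) else 0) * (if u' ν % (P : ℤ) = (P : ℤ) - 1 then (1 : ℝ) else 0) *
            ∑' yw : Site (d + 1) × Site (d + 1), (if yw.1 α % NL = NL - 1 then (1 : ℝ) else 0) * (if yw.2 β % NL = NL - 1 then (1 : ℝ) else 0) *
              W2SymOfK X Lc S M 0 M₂ μ (toSite r') ν u' yw.1 yw.2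
                (Sum.inl α) (Sum.inl β))
        = (if toSite r' μ % (P : ℤ) = (P : ℤ) - 1 then (1 : ℝ) else 0) *
            ((∑' u' : Site (d + 1), (if u' ν % (P : ℤ) = (P : ℤ) - 1 then (1 : ℝ) else 0) *
                ∑' yw : Site (d + 1) × Site (d + 1), (if yw.1 α % NL = NL - 1 then (1 : ℝ) else 0) * (if yw.2 β % NL = NL - 1 then (1 : ℝ) else 0) *
                  mixOfK X Lc M₂ μ (toSite r') ν u' yw.1 yw.2 (Sum.inl α) (Sum.inl β))
             + (∑' u' : Site (d + 1), (if u' ν % (P : ℤ) = (P : ℤ) - 1 then (1 : ℝ) else 0) *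
                ∑' yw : Site (d + 1) × Site (d + 1), (if yw.1 α % NL = NL - 1 then (1 : ℝ) else 0) * (if yw.2 β % NL = NL - 1 then (1 : ℝ) else 0) *
                  mixOfK X Lc M₂ ν u' μ (toSite r') yw.1 yw.2 (Sum.inl α) (Sum.inl β))
             + (1 / 2 : ℝ) * ((∑' u' : Site (d + 1), (if u' ν % (P : ℤ) = (P : ℤ) - 1 then (1 : ℝ) else 0) *
                  ∑' yw : Site (d + 1) × Site (d + 1), (if yw.1 α % NL = NL - 1 then (1 : ℝ) else 0) * (if yw.2 β % NL = NL - 1 then (1 : ℝ) else 0) *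
                    dM (K2OfK X Lc S M ν u') Lc S M μ (toSite r') yw.1 yw.2
                      (Sum.inl α) (Sum.inl β))
               + (∑' u' : Site (d + 1), (if u' ν % (P : ℤ) = (P : ℤ) - 1 then (1 : ℝ) else 0) *
                  ∑' yw : Site (d + 1) × Site (d + 1), (if yw.1 α % NL = NL - 1 then (1 : ℝ) else 0) * (if yw.2 β % NL = NL - 1 then (1 : ℝ) else 0) *
                    dM (K2OfK X Lc S M μ (toSite r')) Lc S M ν u' yw.1 yw.2
                      (Sum.inl α) (Sum.inl β)))) := by
      intro r'
      have hpt : ∀ u' : Site (d + 1),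
          (if toSite r' μ % (P : ℤ) = (P : ℤ) - 1 then (1 : ℝ) else 0) * (if u' ν % (P : ℤ) = (P : ℤ) - 1 then (1 : ℝ) else 0) *
            ∑' yw : Site (d + 1) × Site (d + 1), (if yw.1 α % NL = NL - 1 then (1 : ℝ) else 0) * (if yw.2 β % NL = NL - 1 then (1 : ℝ) else 0) *
              W2SymOfK X Lc S M 0 M₂ μ (toSite r') ν u' yw.1 yw.2
                (Sum.inl α) (Sum.inl β)
          = (if toSite r' μ % (P : ℤ) = (P : ℤ) - 1 then (1 : ℝ) else 0) *
            (((if u' ν % (P : ℤ) = (P : ℤ) - 1 then (1 : ℝ) else 0) *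
                ∑' yw : Site (d + 1) × Site (d + 1), (if yw.1 α % NL = NL - 1 then (1 : ℝ) else 0) * (if yw.2 β % NL = NL - 1 then (1 : ℝ) else 0) *
                  mixOfK X Lc M₂ μ (toSite r') ν u' yw.1 yw.2 (Sum.inl α) (Sum.inl β)
             + (if u' ν % (P : ℤ) = (P : ℤ) - 1 then (1 : ℝ) else 0) *
                ∑' yw : Site (d + 1) × Site (d + 1), (if yw.1 α % NL = NL - 1 then (1 : ℝ) else 0) * (if yw.2 β % NL = NL - 1 then (1 : ℝ) else 0) *
                  mixOfK X Lc M₂ ν u' μ (toSite r') yw.1 yw.2 (Sum.inl α) (Sum.inl β))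
             + (1 / 2 : ℝ) * ((if u' ν % (P : ℤ) = (P : ℤ) - 1 then (1 : ℝ) else 0) *
                  ∑' yw : Site (d + 1) × Site (d + 1), (if yw.1 α % NL = NL - 1 then (1 : ℝ) else 0) * (if yw.2 β % NL = NL - 1 then (1 : ℝ) else 0) *
                    dM (K2OfK X Lc S M ν u') Lc S M μ (toSite r') yw.1 yw.2
                      (Sum.inl α) (Sum.inl β)
               + (if u' ν % (P : ℤ) = (P : ℤ) - 1 then (1 : ℝ) else 0) *
                  ∑' yw : Site (d + 1) × Site (d + 1), (if yw.1 α % NL = NL - 1 then (1 : ℝ) else 0) * (if yw.2 β % NL = NL - 1 then (1 : ℝ) else 0) *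
                    dM (K2OfK X Lc S M μ (toSite r')) Lc S M ν u' yw.1 yw.2
                      (Sum.inl α) (Sum.inl β))) := by
        intro u'
        rw [tsum_facePair_W2SymOfK_zero₂ (N := Lc) hKm hCK0 hm0 hSm hMm hM₂m μ (toSite r') ν u' NL α β (Sum.inl α) (Sum.inl β)]
        ring
      simp only [hpt]
      rw [tsum_mul_left, ((s1 r').add (s2 r')).tsum_add (((s3 r').add (s4 r')).mul_left _), (s1 r').tsum_add (s2 r'), tsum_mul_left,
        (s3 r').tsum_add (s4 r')]
    simp only [hsplit]
    -- the first mixed face word vanishes bond by bond, the second after the sum over the cell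
    have hmix1 : ∀ r' : Fin (d + 1) → ℕ, (∑' u' : Site (d + 1), (if u' ν % (P : ℤ) = (P : ℤ) - 1 then (1 : ℝ) else 0) *
        ∑' yw : Site (d + 1) × Site (d + 1), (if yw.1 α % NL = NL - 1 then (1 : ℝ) else 0) * (if yw.2 β % NL = NL - 1 then (1 : ℝ) else 0) *
          mixOfK X Lc M₂ μ (toSite r') ν u' yw.1 yw.2 (Sum.inl α) (Sum.inl β)) = 0 := by
      intro r'
      have h := tsum_faceBond_mixWord_eq_zero_of_ward (d := d) hX hδ hMw hM₂ hδ₂ μ (toSite r') ν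
        (fun s : ℤ => if s % (P : ℤ) = (P : ℤ) - 1 then (1 : ℝ) else 0) hχ
        (fun yw : Site (d + 1) × Site (d + 1) => (if yw.1 α % NL = NL - 1 then (1 : ℝ) else 0) * (if yw.2 β % NL = NL - 1 then (1 : ℝ) else 0))
        (hmb α β) (Sum.inl α) (Sum.inl β)
      simpa only [mul_assoc] using h
    have hmix2 := sum_box_tsum_mixWord_swap_eq_zero_of_ward (d := d) hX hδ hMw hXt (P := P) hM₂ hδ₂ hM₂t μ ν
      (fun s : ℤ => if s % (P : ℤ) = (P : ℤ) - 1 then (1 : ℝ) else 0) (fun s : ℤ => if s % (P : ℤ) = (P : ℤ) - 1 then (1 : ℝ) else 0) hχ hχ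
      (hχP μ) (hχP ν)
      (fun yw : Site (d + 1) × Site (d + 1) => (if yw.1 α % NL = NL - 1 then (1 : ℝ) else 0) * (if yw.2 β % NL = NL - 1 then (1 : ℝ) else 0))
      (hmb α β) (hmN α β) (Sum.inl α) (Sum.inl β)
    simp only [hmix1, zero_add]
    have hmix2' : ∑ r' ∈ box (d + 1) P, (if toSite r' μ % (P : ℤ) = (P : ℤ) - 1 then (1 : ℝ) else 0) *
        (∑' u' : Site (d + 1), (if u' ν % (P : ℤ) = (P : ℤ) - 1 then (1 : ℝ) else 0) *
          ∑' yw : Site (d + 1) × Site (d + 1), (if yw.1 α % NL = NL - 1 then (1 : ℝ) else 0) * (if yw.2 β % NL = NL - 1 then (1 : ℝ) else 0) *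
            mixOfK X Lc M₂ ν u' μ (toSite r') yw.1 yw.2 (Sum.inl α) (Sum.inl β)) = 0 := by
      refine (Finset.sum_congr rfl fun r' _ => ?_).trans hmix2
      rw [← tsum_mul_left]
      refine tsum_congr fun u' => ?_
      simp only [mul_assoc]
    rw [Finset.mul_sum]
    have e : ∀ r' : Fin (d + 1) → ℕ, (if toSite r' μ % (P : ℤ) = (P : ℤ) - 1 then (1 : ℝ) else 0) *
        ((∑' u' : Site (d + 1), (if u' ν % (P : ℤ) = (P : ℤ) - 1 then (1 : ℝ) else 0) *
            ∑' yw : Site (d + 1) × Site (d + 1), (if yw.1 α % NL = NL - 1 then (1 : ℝ) else 0) * (if yw.2 β % NL = NL - 1 then (1 : ℝ) else 0) *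
              mixOfK X Lc M₂ ν u' μ (toSite r') yw.1 yw.2 (Sum.inl α) (Sum.inl β))
          + (1 / 2 : ℝ) * ((∑' u' : Site (d + 1), (if u' ν % (P : ℤ) = (P : ℤ) - 1 then (1 : ℝ) else 0) *
                ∑' yw : Site (d + 1) × Site (d + 1), (if yw.1 α % NL = NL - 1 then (1 : ℝ) else 0) * (if yw.2 β % NL = NL - 1 then (1 : ℝ) else 0) *
                  dM (K2OfK X Lc S M ν u') Lc S M μ (toSite r') yw.1 yw.2
                    (Sum.inl α) (Sum.inl β))
             + (∑' u' : Site (d + 1), (if u' ν % (P : ℤ) = (P : ℤ) - 1 then (1 : ℝ) else 0) *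
                ∑' yw : Site (d + 1) × Site (d + 1), (if yw.1 α % NL = NL - 1 then (1 : ℝ) else 0) * (if yw.2 β % NL = NL - 1 then (1 : ℝ) else 0) *
                  dM (K2OfK X Lc S M μ (toSite r')) Lc S M ν u' yw.1 yw.2
                    (Sum.inl α) (Sum.inl β))))
        = (if toSite r' μ % (P : ℤ) = (P : ℤ) - 1 then (1 : ℝ) else 0) *
            (∑' u' : Site (d + 1), (if u' ν % (P : ℤ) = (P : ℤ) - 1 then (1 : ℝ) else 0) *
              ∑' yw : Site (d + 1) × Site (d + 1), (if yw.1 α % NL = NL - 1 then (1 : ℝ) else 0) * (if yw.2 β % NL = NL - 1 then (1 : ℝ) else 0) *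
                mixOfK X Lc M₂ ν u' μ (toSite r') yw.1 yw.2 (Sum.inl α) (Sum.inl β))
          + (1 / 2 : ℝ) * ∑' u' : Site (d + 1), (if toSite r' μ % (P : ℤ) = (P : ℤ) - 1 then (1 : ℝ) else 0) * (if u' ν % (P : ℤ) = (P : ℤ) - 1 then (1 : ℝ) else 0) *
            ((∑' yw : Site (d + 1) × Site (d + 1), (if yw.1 α % NL = NL - 1 then (1 : ℝ) else 0) * (if yw.2 β % NL = NL - 1 then (1 : ℝ) else 0) *
                dM (K2OfK X Lc S M ν u') Lc S M μ (toSite r') yw.1 yw.2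
                  (Sum.inl α) (Sum.inl β))
             + (∑' yw : Site (d + 1) × Site (d + 1), (if yw.1 α % NL = NL - 1 then (1 : ℝ) else 0) * (if yw.2 β % NL = NL - 1 then (1 : ℝ) else 0) *
                dM (K2OfK X Lc S M μ (toSite r')) Lc S M ν u' yw.1 yw.2
                  (Sum.inl α) (Sum.inl β))) := by
      intro r'
      have h3 : (∑' u' : Site (d + 1), (if toSite r' μ % (P : ℤ) = (P : ℤ) - 1 then (1 : ℝ) else 0) * (if u' ν % (P : ℤ) = (P : ℤ) - 1 then (1 : ℝ) else 0) *
            ((∑' yw : Site (d + 1) × Site (d + 1), (if yw.1 α % NL = NL - 1 then (1 : ℝ) else 0) * (if yw.2 β % NL = NL - 1 then (1 : ℝ) else 0) *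
                dM (K2OfK X Lc S M ν u') Lc S M μ (toSite r') yw.1 yw.2
                  (Sum.inl α) (Sum.inl β))
             + (∑' yw : Site (d + 1) × Site (d + 1), (if yw.1 α % NL = NL - 1 then (1 : ℝ) else 0) * (if yw.2 β % NL = NL - 1 then (1 : ℝ) else 0) *
                dM (K2OfK X Lc S M μ (toSite r')) Lc S M ν u' yw.1 yw.2
                  (Sum.inl α) (Sum.inl β))))
          = (if toSite r' μ % (P : ℤ) = (P : ℤ) - 1 then (1 : ℝ) else 0) *
            ((∑' u' : Site (d + 1), (if u' ν % (P : ℤ) = (P : ℤ) - 1 then (1 : ℝ) else 0) *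
                  ∑' yw : Site (d + 1) × Site (d + 1), (if yw.1 α % NL = NL - 1 then (1 : ℝ) else 0) * (if yw.2 β % NL = NL - 1 then (1 : ℝ) else 0) *
                    dM (K2OfK X Lc S M ν u') Lc S M μ (toSite r') yw.1 yw.2
                      (Sum.inl α) (Sum.inl β))
               + (∑' u' : Site (d + 1), (if u' ν % (P : ℤ) = (P : ℤ) - 1 then (1 : ℝ) else 0) *
                  ∑' yw : Site (d + 1) × Site (d + 1), (if yw.1 α % NL = NL - 1 then (1 : ℝ) else 0) * (if yw.2 β % NL = NL - 1 then (1 : ℝ) else 0) *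
                    dM (K2OfK X Lc S M μ (toSite r')) Lc S M ν u' yw.1 yw.2
                      (Sum.inl α) (Sum.inl β))) := by
        rw [← (s3 r').tsum_add (s4 r'), ← tsum_mul_left]
        refine tsum_congr fun u' => ?_
        ring
      rw [h3]
      ring
    simp only [e, Finset.sum_add_distrib, hmix2', zero_add]
  -- the response words are odd under the exchange of the two legs
  have hR : ∀ μ ν α β : Fin (d + 1),
      (∑ r' ∈ box (d + 1) P, ∑' u' : Site (d + 1),
          (if toSite r' μ % (P : ℤ) = (P : ℤ) - 1 then (1 : ℝ) else 0) * (if u' ν % (P : ℤ) = (P : ℤ) - 1 then (1 : ℝ) else 0) *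
            ((∑' yw : Site (d + 1) × Site (d + 1), (if yw.1 β % NL = NL - 1 then (1 : ℝ) else 0) * (if yw.2 α % NL = NL - 1 then (1 : ℝ) else 0) *
                dM (K2OfK X Lc S M ν u') Lc S M μ (toSite r') yw.1 yw.2
                  (Sum.inl β) (Sum.inl α))
             + (∑' yw : Site (d + 1) × Site (d + 1), (if yw.1 β % NL = NL - 1 then (1 : ℝ) else 0) * (if yw.2 α % NL = NL - 1 then (1 : ℝ) else 0) *
                dM (K2OfK X Lc S M μ (toSite r')) Lc S M ν u' yw.1 yw.2
                  (Sum.inl β) (Sum.inl α))))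
        = -(∑ r' ∈ box (d + 1) P, ∑' u' : Site (d + 1),
          (if toSite r' μ % (P : ℤ) = (P : ℤ) - 1 then (1 : ℝ) else 0) * (if u' ν % (P : ℤ) = (P : ℤ) - 1 then (1 : ℝ) else 0) *
            ((∑' yw : Site (d + 1) × Site (d + 1), (if yw.1 α % NL = NL - 1 then (1 : ℝ) else 0) * (if yw.2 β % NL = NL - 1 then (1 : ℝ) else 0) *
                dM (K2OfK X Lc S M ν u') Lc S M μ (toSite r') yw.1 yw.2
                  (Sum.inl α) (Sum.inl β))
             + (∑' yw : Site (d + 1) × Site (d + 1), (if yw.1 α % NL = NL - 1 then (1 : ℝ) else 0) * (if yw.2 β % NL = NL - 1 then (1 : ℝ) else 0) *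
                dM (K2OfK X Lc S M μ (toSite r')) Lc S M ν u' yw.1 yw.2
                  (Sum.inl α) (Sum.inl β)))) := by
    intro μ ν α β
    rw [← Finset.sum_neg_distrib]
    refine Finset.sum_congr rfl fun r' _ => ?_
    rw [← tsum_neg]
    refine tsum_congr fun u' => ?_
    rw [resp_facePair_swap NL _ Lc hSrow hMrow μ (toSite r') α β, resp_facePair_swap NL _ Lc hSrow hMrow ν u' α β]
    ring
  intro κ κ' κ₁ κ₂
  simp only [hWw]
  rw [hR κ κ' κ₁ κ₂, hR κ' κ κ₁ κ₂]
  ring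

end Ward

/-! ## §2 The (III′) instance `X̃′_j = unitK s_f s_m (GcombSh Lc j)` -/

section CombStep

variable (Lc)

/-- NOT IN PRINT; OUR BOOKKEEPING.  **(III′) — `hW0` FOR THE COMB-CHART DRESSED STEP** (every `j`, ANY units): the leg-symmetrised `W` face word of
`W̃′ = W2SymOfK X̃′_j Lc S M 0 M₂`, `X̃′_j = unitK s_f s_m (GcombSh Lc j)`, vanishes — §1 at an2's `colM_GcombSh_ward` ∕ `decays_GcombSh` ∕ `shiftK_GcombSh`; the (III′) twin of MY Part 50b
`faceWWord_LS_eq_zero`. -/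
theorem faceWWord_LS_combStep_eq_zero (sf sm : ℝ) (j : ℕ) {P : ℕ} [NeZero P]
    {S M : Fin (d + 1) → (Fin (d + 1) → ℤ) → MKer (d + 1) (Fib d)} {Cs δs CM δM : ℝ}
    (hS : LocStencil S Cs δs) (hδs : 0 < δs) (hM : VertexFamily M Lc CM δM) (hδM : 0 < δM)
    (hSrow : ∀ κ u, trK (S κ u) = -sgnK (S κ u)) (hMrow : ∀ ρ w, trK (M ρ w) = -sgnK (M ρ w))
    {M₂ : Fin (d + 1) → Site (d + 1) → Fin (d + 1) → Site (d + 1) → MKer (d + 1) (Fib d)} {C₂ δ₂ : ℝ} (hM₂ : LocStencilFM Lc M₂ C₂ δ₂) (hδ₂ : 0 < δ₂)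
    (hM₂t : ∀ (κ : Fin (d + 1)) (u : Site (d + 1)) (ρ : Fin (d + 1)) (w t : Site (d + 1)), M₂ κ (u + (Lc : ℤ) • t) ρ (w + t) = shiftK (-((Lc : ℤ) • t)) (M₂ κ u ρ w))
    (NL : ℤ) (hNL : NL ∣ (Lc : ℤ) * (P : ℤ)) :
    ∀ κ κ' κ₁ κ₂ : Fin (d + 1),
      (fun μ ν α β : Fin (d + 1) => ∑ r' ∈ box (d + 1) P, ∑' u' : Site (d + 1),
          (if toSite r' μ % (P : ℤ) = (P : ℤ) - 1 then (1 : ℝ) else 0) * (if u' ν % (P : ℤ) = (P : ℤ) - 1 then (1 : ℝ) else 0) *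
            ∑' yw : Site (d + 1) × Site (d + 1), (if yw.1 α % NL = NL - 1 then (1 : ℝ) else 0) * (if yw.2 β % NL = NL - 1 then (1 : ℝ) else 0) *
              W2SymOfK (unitK sf sm (GcombSh (d := d) Lc j)) Lc S M 0 M₂ μ (toSite r') ν u' yw.1 yw.2
                (Sum.inl α) (Sum.inl β)) κ κ' κ₁ κ₂
      + (fun μ ν α β : Fin (d + 1) => ∑ r' ∈ box (d + 1) P, ∑' u' : Site (d + 1),
          (if toSite r' μ % (P : ℤ) = (P : ℤ) - 1 then (1 : ℝ) else 0) * (if u' ν % (P : ℤ) = (P : ℤ) - 1 then (1 : ℝ) else 0) *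
            ∑' yw : Site (d + 1) × Site (d + 1), (if yw.1 α % NL = NL - 1 then (1 : ℝ) else 0) * (if yw.2 β % NL = NL - 1 then (1 : ℝ) else 0) *
              W2SymOfK (unitK sf sm (GcombSh (d := d) Lc j)) Lc S M 0 M₂ μ (toSite r') ν u' yw.1 yw.2
                (Sum.inl α) (Sum.inl β)) κ' κ κ₁ κ₂
      + ((fun μ ν α β : Fin (d + 1) => ∑ r' ∈ box (d + 1) P, ∑' u' : Site (d + 1),
          (if toSite r' μ % (P : ℤ) = (P : ℤ) - 1 then (1 : ℝ) else 0) * (if u' ν % (P : ℤ) = (P : ℤ) - 1 then (1 : ℝ) else 0) *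
            ∑' yw : Site (d + 1) × Site (d + 1), (if yw.1 α % NL = NL - 1 then (1 : ℝ) else 0) * (if yw.2 β % NL = NL - 1 then (1 : ℝ) else 0) *
              W2SymOfK (unitK sf sm (GcombSh (d := d) Lc j)) Lc S M 0 M₂ μ (toSite r') ν u' yw.1 yw.2
                (Sum.inl α) (Sum.inl β)) κ κ' κ₂ κ₁
      + (fun μ ν α β : Fin (d + 1) => ∑ r' ∈ box (d + 1) P, ∑' u' : Site (d + 1),
          (if toSite r' μ % (P : ℤ) = (P : ℤ) - 1 then (1 : ℝ) else 0) * (if u' ν % (P : ℤ) = (P : ℤ) - 1 then (1 : ℝ) else 0) *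
            ∑' yw : Site (d + 1) × Site (d + 1), (if yw.1 α % NL = NL - 1 then (1 : ℝ) else 0) * (if yw.2 β % NL = NL - 1 then (1 : ℝ) else 0) *
              W2SymOfK (unitK sf sm (GcombSh (d := d) Lc j)) Lc S M 0 M₂ μ (toSite r') ν u' yw.1 yw.2
                (Sum.inl α) (Sum.inl β)) κ' κ κ₂ κ₁) = 0 := by
  obtain ⟨δ, C, hδ, _, hK⟩ := decays_GcombSh (d := d) Lc j
  exact faceWWord_LS_eq_zero_of_ward (decays_unitK hK) hδ
    (colM_ward_unitK (fun y ρ w => colM_GcombSh_ward (d := d) (Lc := Lc) j y ρ w) sf sm)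
    (shiftK_unitK_of_shiftK (fun t => shiftK_GcombSh (d := d) Lc j t) sf sm) hS hδs hM hδM hSrow hMrow hM₂ hδ₂ hM₂t NL hNL

end CombStep

end Summit.QuantumFields.BalabanUV.Beta.GAN24.FaceWWordVanishingOfWardLetters

end
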